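import Summits.BirchSwinnertonDyer.Rank1Residual.Partition.EisensteinKernelRealPoints
import Literature.NumberTheory.EllipticCurves.Rank1Residual.GVParityOrdinaryLineProofs
import HarnessLib

/-!
# Ramification of a rational `p`-line at a GOOD ORDINARY odd `p`, read off the reduction of its
# points: `Φ` is ramified at `p` iff `Φ = ker(E[p] → Ẽ)` iff the abscissa of its points is not
# `𝔓`-integral

HONEST FRAMING (cell `b2b-bsdres-*`, verbatim): the goal of the cell is to DELETE the
COMBINATION-SHAPED residual classes for ALL analytic-rank ≤ 1 curves over ℚ — "full BSD formula
for every rank ≤ 1 curve in class C" assembled STRICTLY from published theorems — so that the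
rank-≤1 remainder becomes exactly the CONSTRUCTION-SHAPED classes, which are TYPED (missing-input
Props), NOT attempted; this is not "finishing BSD". Off-peak literature typer `b2b-bsdres-lit-cgls`
(CGLS22 / GV00, the reducible = Eisenstein column), session 14, file 2 of 2: an ELEMENTARY REDUCTION
of the Eisenstein column at every GOOD ORDINARY odd prime — theorems only, no definition, no named
fact, nothing booked, no label changed.

WHY. The second half of the lane's decision procedure of record for `GVPar W p` (bsdN/HYPOTHESES.md
row T-GV0: "ramified ⇔ `H` not `p`-integral (`Φ` = kernel of reduction on the minimal model)") —
theory-level at `p = 3` since session 13 (`KernelDisc.lineUnramifiedAt_three_iff_den_eq_one`) — as a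
theorem at every good ordinary odd `p` of a globally minimal `E/ℚ`, for every rational `p`-line `Φ`
and any non-zero `P = (x, y) ∈ Φ`. Local input: Serre's ordinary line (Invent. Math. 15 (1972) §1.11
Prop. 11, Cor.; tree `exists_line_of_not_dvd_frobeniusTrace`: the reduction map `geomReduction`
along the place `𝔓` over `p` is `I_𝔓`-invariant and non-zero on `E[p]`) and its inertia character
onto `𝔽_pˣ` (`exists_mem_inertia_smul_eq_of_sub_mem_line`, Weil pairing):

* §1 `lineUnramifiedAt_iff_forall_mem_inertia` — unramified at `p` iff the inertia group of ONE
  prime of `\bar ℤ` above `p` fixes `Φ` (primes above `p` and their inertia groups are conjugate;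
  `Φ` is `Γ_ℚ`-stable) [folklore];
* §2 at the place's prime: `geomReduction_coe_eq_zero_of_inertia_moves` (if `I_𝔓` moves a point of
  `Φ` then `Φ ⊆ ker red`), `exists_inertia_smul_ne_of_geomReduction_eq_zero` (if a non-zero point of
  `Φ` reduces to `Õ` then `Φ = ker(red|E[p]) ∋` Serre's `v₀`, moved by some `τ ∈ I_𝔓`); hence
  **`forall_inertia_smul_eq_iff_geomReduction_ne_zero`**: `I_𝔓` fixes `Φ` iff `red P ≠ Õ`;
* §3 **`lineUnramifiedAt_iff_valuation_le_one`**: `LineUnramifiedAt W p Φ ↔ v_𝔓(x) ≤ 1` — the line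
  is unramified at `p` iff the abscissa of (one, equivalently every) non-zero point is `𝔓`-integral
  (Silverman *AEC* VII.2.1: `red(x, y) = Õ` iff `x ∉ 𝒪_𝔓`); `not_lineUnramifiedAt_iff_one_lt_valuation`;
* §4 CERTIFICATE shapes: `lineUnramifiedAt_of_isIntegral` (`x·d` integral over `ℤ` with `p ∤ d` —
  e.g. `x` a root of a `p`-integral monic kernel polynomial — ⇒ unramified),
  `not_lineUnramifiedAt_of_isIntegral_inv` (`x·p·s = d` with `s` integral, `p ∤ d` ⇒ ramified), and
  with file 1 (`EisensteinKernelRealPoints`) the GV type: `gvPar_of_one_lt_valuation_of_forall_real_root_pos`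
  (ramified ∧ even), `gvPar_of_valuation_le_one_of_forall_real_root_neg` (unramified ∧ odd).

References: J.-P. Serre, Invent. Math. 15 (1972) §1.11 Prop. 11, Cor. [Serre1972]; R. Greenberg,
V. Vatsal, Invent. Math. 142 (2000), Thm. 1.3 and p. 26 ("`C[p] = μ_p`") [GreenbergVatsal2000];
J. H. Silverman, *AEC*, GTM 106 (2009), VII.2.1, VII.3.1 [SilvermanAEC2009]; bsdN/HYPOTHESES.md row
T-GV0; HOME/b2b-bsdres-lit-cgls/CGLS-GV-TYPING.md §21.
-/

set_option autoImplicit false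

noncomputable section

open scoped Classical NumberField

open WeierstrassCurve Polynomial Literature.NumberTheory.EllipticCurves
  Literature.NumberTheory.EllipticCurves.Rank1Residual Literature.NumberTheory.GaloisRepresentations
  Field IsDedekindDomain NumberField Rat.HeightOneSpectrum

namespace Summit.BirchSwinnertonDyer.Rank1Residual

namespace KernelDisc

variable {W : WeierstrassCurve ℚ} {p : ℕ} [Fact p.Prime] {Φ : AddSubgroup (geomTorsion W (p : ℤ))}

/-! ### §1. Unramified at `p` iff ONE inertia group above `p` fixes the line -/

/-- The place of `ℚ` above `p` contains `p`. [folklore] -/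
theorem natCast_mem_asIdeal_primesEquiv_symm :
    (p : 𝓞 ℚ) ∈ ((primesEquiv (R := 𝓞 ℚ)).symm ⟨p, Fact.out⟩).asIdeal := by
  have hp : p.Prime := Fact.out
  set v := (primesEquiv (R := 𝓞 ℚ)).symm ⟨p, hp⟩ with hv
  have h1 : natGenerator v = p :=
    congrArg Subtype.val ((primesEquiv (R := 𝓞 ℚ)).apply_symm_apply ⟨p, hp⟩)
  have h2 := (natGenerator_dvd_iff v).mp (dvd_refl _)
  rw [h1, Ideal.mem_map_of_equiv] at h2
  obtain ⟨x, hx, hxp⟩ := h2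
  rwa [(Rat.IsIntegralClosure.intEquiv (𝓞 ℚ)).injective (hxp.trans (map_natCast _ p).symm)] at hx

/-- Two finite places of `ℚ` containing the prime `p` are equal. [folklore] -/
theorem heightOneSpectrum_eq_of_natCast_mem {v v' : HeightOneSpectrum (𝓞 ℚ)}
    (hv : (p : 𝓞 ℚ) ∈ v.asIdeal) (hv' : (p : 𝓞 ℚ) ∈ v'.asIdeal) : v = v' := by
  have hp : p.Prime := Fact.out
  apply (primesEquiv (R := 𝓞 ℚ)).injective
  exact Subtype.ext ((primesEquiv_eq_of_natCast_mem hp hv).trans (primesEquiv_eq_of_natCast_mem hp hv').symm)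

/-- **Unramified at `p` iff the inertia group of ONE prime above `p` fixes the line.** For a rational
`p`-line `Φ`, a finite place `v ∋ p` of `ℚ` and a prime `𝔓` of `\bar ℤ` above `v`:
`LineUnramifiedAt W p Φ ↔ ∀ σ ∈ I_𝔓, ∀ P ∈ Φ, σP = P`. The primes above `p` are the conjugates
`g𝔓` (`exists_smul_eq_of_mem_primesAbove_holds`), `I_{g𝔓} = g I_𝔓 g⁻¹`, and `gΦ = Φ`. [folklore] -/
theorem lineUnramifiedAt_iff_forall_mem_inertia (hΦ : IsRationalLine W p Φ)
    {v : HeightOneSpectrum (𝓞 ℚ)} (hv : (p : 𝓞 ℚ) ∈ v.asIdeal)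
    {𝔓 : Ideal (absIntegers (𝓞 ℚ) ℚ)} (h𝔓 : 𝔓 ∈ v.primesAbove) :
    LineUnramifiedAt W p Φ ↔ ∀ σ ∈ 𝔓.inertia (absoluteGaloisGroup ℚ), ∀ P ∈ Φ, σ • P = P := by
  refine ⟨fun h ↦ h v hv 𝔓 h𝔓, fun h v' hv' 𝔓' h𝔓' σ hσ P hP ↦ ?_⟩
  have hvv : v = v' := heightOneSpectrum_eq_of_natCast_mem hv hv'
  subst hvv
  obtain ⟨g, hg⟩ :=
    HeightOneSpectrum.exists_smul_eq_of_mem_primesAbove_holds (K := ℚ) (v := v) h𝔓 h𝔓'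
  rw [← hg] at hσ
  have hτ : g⁻¹ * σ * g ∈ 𝔓.inertia (absoluteGaloisGroup ℚ) :=
    DegreeOnePrimes.conj_mem_inertia_of_mem_inertia_smul hσ
  have key := h _ hτ _ (hΦ.2 g⁻¹ P hP)
  rw [mul_smul, mul_smul, smul_inv_smul] at key
  exact MulAction.injective g⁻¹ key

/-! ### §2. At the place's prime: `I_𝔓` moves `Φ` iff the points of `Φ` reduce to `Õ` -/

/-- Coprime annihilators kill: `a • x = 0`, `b • x = 0`, `gcd(a, b) = 1` ⇒ `x = 0`. [folklore] -/
theorem eq_zero_of_zsmul_eq_zero_of_isCoprime {A : Type*} [AddCommGroup A] {a b : ℤ} {x : A}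
    (ha : a • x = 0) (hb : b • x = 0) (h : IsCoprime a b) : x = 0 := by
  obtain ⟨u, w, huw⟩ := h
  calc x = (1 : ℤ) • x := (one_zsmul x).symm
    _ = (u * a + w * b) • x := by rw [huw]
    _ = 0 := by rw [add_smul, ← smul_smul, ← smul_smul, ha, hb, smul_zero, smul_zero, add_zero]

/-- A subgroup of `E[p]` of order `p` is generated by any of its non-zero points. [folklore] -/
theorem eq_zmultiples_of_card_eq {K : AddSubgroup (geomTorsion W (p : ℤ))} (hK : Nat.card K = p)
    {P : geomTorsion W (p : ℤ)} (hP : P ∈ K) (hP0 : P ≠ 0) : K = AddSubgroup.zmultiples P := by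
  have hp : p.Prime := Fact.out
  have hpP : (p : ℤ) • P = 0 := by
    have h : Nat.card K • (⟨P, hP⟩ : K) = 0 := card_nsmul_eq_zero'
    rw [hK] at h
    have h' := congrArg Subtype.val h
    rw [← natCast_zsmul, AddSubgroupClass.coe_zsmul] at h'
    exact h'
  have hord : addOrderOf P = p := by
    have hdvd : addOrderOf P ∣ p := by
      apply addOrderOf_dvd_of_nsmul_eq_zero; rwa [natCast_zsmul] at hpP
    rcases (Nat.dvd_prime hp).mp hdvd with h1 | h1
    · exact absurd (AddMonoid.addOrderOf_eq_one_iff.mp h1) hP0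
    · exact h1
  haveI : Finite K := Nat.finite_of_card_ne_zero (by rw [hK]; exact hp.ne_zero)
  symm
  apply AddSubgroup.eq_of_le_of_card_ge
  · exact AddSubgroup.zmultiples_le_of_mem hP
  · rw [hK, Nat.card_zmultiples, hord]

section Place

variable [W.IsElliptic] [W.IsGloballyMinimal]

/-- **If `I_𝔓` moves a point of `Φ`, every point of `Φ` reduces to `Õ`** (`𝔓` the place's prime):
the mover acts on `Φ = ℤQ` by `σQ = kQ`, `p ∤ k − 1`, and `red` is `I_𝔓`-invariant
(`geomReduction_smul_of_mem_inertia`), so `(k − 1)·red Q = 0 = p·red Q`, `red Q = 0`. [folklore] -/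
theorem geomReduction_coe_eq_zero_of_inertia_moves (hΦ : IsRationalLine W p Φ)
    (hΔ : ¬ (p : ℤ) ∣ minimalDiscriminantInt W) {𝔓 : Ideal (absIntegers (𝓞 ℚ) ℚ)}
    (hmem : ∀ z : absIntegers (𝓞 ℚ) ℚ, z ∈ 𝔓 ↔ (z : AlgebraicClosure ℚ) ∈ (placeOver p).nonunits)
    (hmov : ∃ σ ∈ 𝔓.inertia (absoluteGaloisGroup ℚ), ∃ Q ∈ Φ, σ • Q ≠ Q)
    {P : geomTorsion W (p : ℤ)} (hP : P ∈ Φ) : geomReduction hΔ (P : W.geomPoints) = 0 := by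
  have hp : p.Prime := Fact.out
  have hprime : Prime (p : ℤ) := Nat.prime_iff_prime_int.mp hp
  obtain ⟨σ, hσ, Q, hQ, hne⟩ := hmov
  have hQ0 : Q ≠ 0 := by rintro rfl; exact hne (smul_zero σ)
  have hΦQ := eq_zmultiples_of_mem hΦ hQ hQ0
  -- `σ • Q = k • Q`
  have hσQ : σ • Q ∈ Φ := hΦ.2 σ Q hQ
  rw [hΦQ, AddSubgroup.mem_zmultiples_iff] at hσQ
  obtain ⟨k, hk⟩ := hσQ
  -- `red (σ • Q) = red Q`, i.e. `k • red Q = red Q`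
  have hinv := geomReduction_smul_of_mem_inertia hΔ hmem hσ (Q : W.geomPoints)
  rw [← AddSubgroup.torsionBy.coe_smul, ← hk, AddSubgroupClass.coe_zsmul, map_zsmul] at hinv
  have h1 : (k - 1) • geomReduction hΔ (Q : W.geomPoints) = 0 := by
    rw [sub_smul, one_smul, hinv, sub_self]
  have hpQ : (p : ℤ) • geomReduction hΔ (Q : W.geomPoints) = 0 := by
    rw [← map_zsmul, (Submodule.mem_torsionBy_iff _ _).mp Q.2, map_zero]
  -- `p ∤ k - 1` (else `σ • Q = Q`)
  have hndvd : ¬ (p : ℤ) ∣ k - 1 := by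
    rintro ⟨t, ht⟩
    apply hne
    rw [← hk, show k = 1 + (p : ℤ) * t by linarith, add_smul, one_smul, mul_comm, mul_smul,
      zsmul_eq_zero_of_mem hΦ hQ, smul_zero, add_zero]
  have hQred : geomReduction hΔ (Q : W.geomPoints) = 0 :=
    eq_zero_of_zsmul_eq_zero_of_isCoprime hpQ h1 ((Prime.coprime_iff_not_dvd hprime).mpr hndvd)
  -- `P = m • Q`
  have hPm : P ∈ AddSubgroup.zmultiples Q := hΦQ ▸ hP
  obtain ⟨m, rfl⟩ := AddSubgroup.mem_zmultiples_iff.mp hPm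
  rw [AddSubgroupClass.coe_zsmul, map_zsmul, hQred, smul_zero]

/-- **If a non-zero point of `Φ` reduces to `Õ`, `I_𝔓` moves a point of `Φ`** (good ordinary odd `p`):
Serre's line `𝔽_p v₀` carries `τ ∈ I_𝔓` acting by `−1`, so `v₀ ∈ ker red` (`p` odd); `ker(red|E[p])`
is proper (`red|E[p] ≠ 0`) and non-trivial in `E[p] ≅ (ℤ/p)²`, so of order `p`, generated by `P` and
by `v₀`: `v₀ ∈ Φ` and `τv₀ = −v₀ ≠ v₀`. [folklore] -/
theorem exists_inertia_smul_ne_of_geomReduction_eq_zero (hΦ : IsRationalLine W p Φ) (hp2 : p ≠ 2)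
    (hΔ : ¬ (p : ℤ) ∣ minimalDiscriminantInt W) (hord : ¬ (p : ℤ) ∣ W.frobeniusTrace p)
    {v : HeightOneSpectrum (𝓞 ℚ)} (hvp : (primesEquiv v : ℕ) = p)
    {𝔓 : Ideal (absIntegers (𝓞 ℚ) ℚ)}
    (hmem : ∀ z : absIntegers (𝓞 ℚ) ℚ, z ∈ 𝔓 ↔ (z : AlgebraicClosure ℚ) ∈ (placeOver p).nonunits)
    (h𝔓 : 𝔓 ∈ v.primesAbove) {P : geomTorsion W (p : ℤ)} (hP : P ∈ Φ) (hP0 : P ≠ 0)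
    (hred : geomReduction hΔ (P : W.geomPoints) = 0) :
    ∃ σ ∈ 𝔓.inertia (absoluteGaloisGroup ℚ), ∃ Q ∈ Φ, σ • Q ≠ Q := by
  letI : Module (ZMod p) (geomTorsion W (p : ℤ)) := AddSubgroup.torsionBy.zmodModule
  have hp : p.Prime := Fact.out
  have hprime : Prime (p : ℤ) := Nat.prime_iff_prime_int.mp hp
  -- Serre's line and an inertia element acting by `-1` on it
  obtain ⟨v₀, hv₀, hline⟩ := exists_line_of_not_dvd_frobeniusTrace p hΔ hord hmem
  obtain ⟨τ, hτ, hτv⟩ := exists_mem_inertia_smul_eq_of_sub_mem_line W p hvp h𝔓 hv₀ hline (-1)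
  rw [Units.val_neg, Units.val_one, neg_smul, one_smul] at hτv
  -- `v₀ ∈ ker red`
  have hv₀red : geomReduction hΔ (v₀ : W.geomPoints) = 0 := by
    have hinv := geomReduction_smul_of_mem_inertia hΔ hmem hτ (v₀ : W.geomPoints)
    rw [← AddSubgroup.torsionBy.coe_smul, hτv, AddSubgroup.coe_neg, map_neg] at hinv
    have h2 : (2 : ℤ) • geomReduction hΔ (v₀ : W.geomPoints) = 0 := by
      rw [two_zsmul]; nth_rewrite 1 [← hinv]; exact neg_add_cancel _
    have hpv : (p : ℤ) • geomReduction hΔ (v₀ : W.geomPoints) = 0 := by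
      rw [← map_zsmul, (Submodule.mem_torsionBy_iff _ _).mp v₀.2, map_zero]
    exact eq_zero_of_zsmul_eq_zero_of_isCoprime hpv h2 ((Prime.coprime_iff_not_dvd hprime).mpr
      fun h ↦ hp2 ((Nat.prime_dvd_prime_iff_eq hp Nat.prime_two).mp (Int.natCast_dvd_natCast.mp h)))
  -- the kernel `K` of `red` on `E[p]` has order `p`
  set f : geomTorsion W (p : ℤ) →+ (reductionModPrime W p).geomPoints :=
    (geomReduction hΔ).comp (geomTorsion W (p : ℤ)).subtype with hf
  set K : AddSubgroup (geomTorsion W (p : ℤ)) := f.ker with hKdef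
  have hfapply : ∀ T : geomTorsion W (p : ℤ), f T = geomReduction hΔ (T : W.geomPoints) := fun T ↦ rfl
  have hPK : P ∈ K := by rw [hKdef, AddMonoidHom.mem_ker, hfapply, hred]
  have hv₀K : v₀ ∈ K := by rw [hKdef, AddMonoidHom.mem_ker, hfapply, hv₀red]
  have hcard := Literature.NumberTheory.EllipticCurves.Rank1Residual.natCard_geomTorsion W p
  haveI : Finite (geomTorsion W (p : ℤ)) :=
    Nat.finite_of_card_ne_zero (by rw [hcard]; exact pow_ne_zero 2 hp.ne_zero)
  have hKtop : K ≠ ⊤ := by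
    obtain ⟨P', hP', hredP'⟩ := exists_zsmul_eq_zero_geomReduction_ne_zero p hΔ hord
    intro htop
    have hmemK : (⟨P', (Submodule.mem_torsionBy_iff _ _).mpr hP'⟩ : geomTorsion W (p : ℤ)) ∈ K :=
      htop ▸ AddSubgroup.mem_top _
    rw [hKdef, AddMonoidHom.mem_ker, hfapply] at hmemK
    exact hredP' hmemK
  have hKbot : K ≠ ⊥ := fun hbot ↦ hv₀ (by rw [hbot] at hv₀K; exact (AddSubgroup.mem_bot).mp hv₀K)
  have hK : Nat.card K = p := by
    have hdvd : Nat.card K ∣ p ^ 2 := hcard ▸ K.card_addSubgroup_dvd_card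
    obtain ⟨i, hi, hKi⟩ := (Nat.dvd_prime_pow hp).mp hdvd
    interval_cases i
    · exact absurd (AddSubgroup.card_eq_one.mp (by simpa using hKi)) hKbot
    · simpa using hKi
    · exact absurd ((AddSubgroup.card_eq_iff_eq_top K).mp (by rw [hKi, hcard])) hKtop
  -- `Φ = ℤP = K ∋ v₀`
  have hΦK : Φ = K := (eq_zmultiples_of_mem hΦ hP hP0).trans (eq_zmultiples_of_card_eq hK hPK hP0).symm
  have hv₀Φ : v₀ ∈ Φ := hΦK ▸ hv₀K
  refine ⟨τ, hτ, v₀, hv₀Φ, fun h ↦ two_smul_ne_zero hΦ hp2 hv₀Φ hv₀ ?_⟩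
  rw [two_nsmul]; nth_rewrite 1 [← h]; rw [hτv]; exact neg_add_cancel v₀

/-- **`I_𝔓` fixes the rational line `Φ` iff its non-zero points do not reduce to `Õ`** (good ordinary
odd `p`, `𝔓` the place's prime over `p`, `P ∈ Φ` non-zero). [folklore] -/
theorem forall_inertia_smul_eq_iff_geomReduction_ne_zero (hΦ : IsRationalLine W p Φ) (hp2 : p ≠ 2)
    (hΔ : ¬ (p : ℤ) ∣ minimalDiscriminantInt W) (hord : ¬ (p : ℤ) ∣ W.frobeniusTrace p)
    {v : HeightOneSpectrum (𝓞 ℚ)} (hvp : (primesEquiv v : ℕ) = p)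
    {𝔓 : Ideal (absIntegers (𝓞 ℚ) ℚ)}
    (hmem : ∀ z : absIntegers (𝓞 ℚ) ℚ, z ∈ 𝔓 ↔ (z : AlgebraicClosure ℚ) ∈ (placeOver p).nonunits)
    (h𝔓 : 𝔓 ∈ v.primesAbove) {P : geomTorsion W (p : ℤ)} (hP : P ∈ Φ) (hP0 : P ≠ 0) :
    (∀ σ ∈ 𝔓.inertia (absoluteGaloisGroup ℚ), ∀ Q ∈ Φ, σ • Q = Q) ↔
      geomReduction hΔ (P : W.geomPoints) ≠ 0 := by
  constructor
  · intro h hred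
    obtain ⟨σ, hσ, Q, hQ, hne⟩ :=
      exists_inertia_smul_ne_of_geomReduction_eq_zero hΦ hp2 hΔ hord hvp hmem h𝔓 hP hP0 hred
    exact hne (h σ hσ Q hQ)
  · intro h σ hσ Q hQ
    by_contra hne
    exact h (geomReduction_coe_eq_zero_of_inertia_moves hΦ hΔ hmem ⟨σ, hσ, Q, hQ, hne⟩ hP)

/-! ### §3. In coordinates: unramified iff the abscissa is `𝔓`-integral -/

omit [W.IsElliptic] in
/-- **The kernel of reduction in coordinates** (Silverman *AEC* VII.2.1): `red(x, y) = Õ` iff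
`x ∉ 𝒪_𝔓`, i.e. `v_𝔓(x) > 1`. [folklore] -/
theorem geomReduction_some_eq_zero_iff (hΔ : ¬ (p : ℤ) ∣ minimalDiscriminantInt W)
    {x y : AlgebraicClosure ℚ} (h : (W.baseChange (AlgebraicClosure ℚ)).toAffine.Nonsingular x y) :
    geomReduction hΔ (.some x y h) = 0 ↔ 1 < (placeOver p).valuation x := by
  rw [geomReduction_eq_zero_iff, Affine.Point.congrEquiv_some, WeierstrassCurve.reducesToZero_some_iff]
  exact not_mem_range_iff (integers_placeOver p)

omit [W.IsElliptic] in
/-- The same for a point given with its coordinates `Q = (x, y)`. [folklore] -/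
theorem geomReduction_eq_zero_iff_one_lt (hΔ : ¬ (p : ℤ) ∣ minimalDiscriminantInt W)
    {Q : W.geomPoints} {x y : AlgebraicClosure ℚ}
    {h : (W.baseChange (AlgebraicClosure ℚ)).toAffine.Nonsingular x y} (hQ : Q = Affine.Point.some x y h) :
    geomReduction hΔ Q = 0 ↔ 1 < (placeOver p).valuation x := by
  subst hQ
  exact geomReduction_some_eq_zero_iff hΔ h

/-- **Unramified iff the abscissa is `𝔓`-integral.** For `E/ℚ` given by a globally minimal `W` with
GOOD ORDINARY reduction at the odd prime `p`, a rational line `Φ ≤ E[p]`, a non-zero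
`P = (x, y) ∈ Φ`, and the tree's place `𝔓` of `ℚ̄` over `p` (`placeOver p`): `Φ` is UNRAMIFIED at
`p` iff `v_𝔓(x) ≤ 1`; i.e. RAMIFIED iff `Φ = ker(E[p] → Ẽ(𝔽̄_p))` iff `x ∉ 𝒪_𝔓` — T-GV0's
"ramified ⇔ kernel of reduction ⇔ `H` not `p`-integral". [folklore] -/
theorem lineUnramifiedAt_iff_valuation_le_one (hΦ : IsRationalLine W p Φ) (hp2 : p ≠ 2)
    (hgood : W.HasGoodReductionAtPrime p) (hord : ¬ (p : ℤ) ∣ W.frobeniusTrace p)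
    {P : geomTorsion W (p : ℤ)} (hPΦ : P ∈ Φ) (hP0 : P ≠ 0)
    {x y : AlgebraicClosure ℚ} {h : (W.baseChange (AlgebraicClosure ℚ)).toAffine.Nonsingular x y}
    (hP : (P : W.geomPoints) = Affine.Point.some x y h) :
    LineUnramifiedAt W p Φ ↔ (placeOver p).valuation x ≤ 1 := by
  have hp : p.Prime := Fact.out
  have hΔ : ¬ (p : ℤ) ∣ minimalDiscriminantInt W :=
    W.not_dvd_minimalDiscriminantInt_of_hasGoodReductionAtPrime' p hgood
  set v := (primesEquiv (R := 𝓞 ℚ)).symm ⟨p, hp⟩ with hvdef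
  have hvp : (primesEquiv v : ℕ) = p :=
    congrArg Subtype.val ((primesEquiv (R := 𝓞 ℚ)).apply_symm_apply ⟨p, hp⟩)
  have hv : (p : 𝓞 ℚ) ∈ v.asIdeal := natCast_mem_asIdeal_primesEquiv_symm
  obtain ⟨𝔓, hmem, h𝔓⟩ := exists_ideal_placeOver p hvp
  rw [lineUnramifiedAt_iff_forall_mem_inertia hΦ hv h𝔓,
    forall_inertia_smul_eq_iff_geomReduction_ne_zero hΦ hp2 hΔ hord hvp hmem h𝔓 hPΦ hP0, Ne,
    geomReduction_eq_zero_iff_one_lt hΔ hP, not_lt]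

/-- **Ramified iff the abscissa is not `𝔓`-integral** (same data). [folklore] -/
theorem not_lineUnramifiedAt_iff_one_lt_valuation (hΦ : IsRationalLine W p Φ) (hp2 : p ≠ 2)
    (hgood : W.HasGoodReductionAtPrime p) (hord : ¬ (p : ℤ) ∣ W.frobeniusTrace p)
    {P : geomTorsion W (p : ℤ)} (hPΦ : P ∈ Φ) (hP0 : P ≠ 0)
    {x y : AlgebraicClosure ℚ} {h : (W.baseChange (AlgebraicClosure ℚ)).toAffine.Nonsingular x y}
    (hP : (P : W.geomPoints) = Affine.Point.some x y h) :
    ¬ LineUnramifiedAt W p Φ ↔ 1 < (placeOver p).valuation x := by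
  rw [lineUnramifiedAt_iff_valuation_le_one hΦ hp2 hgood hord hPΦ hP0 hP, not_le]

/-! ### §4. Certificate shapes, and the Greenberg–Vatsal type with file 1 -/

omit [W.IsElliptic] [W.IsGloballyMinimal] in
/-- Integral over `ℤ` ⇒ integral over the valuation ring `𝒪_𝔓 ⊇ ℤ`. [folklore] -/
theorem isIntegral_placeOver_of_isIntegral_int {z : AlgebraicClosure ℚ} (hz : IsIntegral ℤ z) :
    IsIntegral (placeOver p) z := by
  obtain ⟨G, hG, hGz⟩ := hz
  refine ⟨G.map (Int.castRingHom (placeOver p)), hG.map _, ?_⟩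
  rw [eval₂_map, RingHom.ext_int ((algebraMap (placeOver p) (AlgebraicClosure ℚ)).comp
    (Int.castRingHom (placeOver p))) (algebraMap ℤ (AlgebraicClosure ℚ))]
  exact hGz

/-- **Unramified certificate**: if `x · d` is integral over `ℤ` for an integer `d` prime to `p` (e.g.
`x` is a root of a MONIC `p`-integral kernel polynomial, denominators cleared), then `v_𝔓(x) ≤ 1`
and `Φ` is unramified at `p`. [folklore] -/
theorem lineUnramifiedAt_of_isIntegral (hΦ : IsRationalLine W p Φ) (hp2 : p ≠ 2)
    (hgood : W.HasGoodReductionAtPrime p) (hord : ¬ (p : ℤ) ∣ W.frobeniusTrace p)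
    {P : geomTorsion W (p : ℤ)} (hPΦ : P ∈ Φ) (hP0 : P ≠ 0)
    {x y : AlgebraicClosure ℚ} {h : (W.baseChange (AlgebraicClosure ℚ)).toAffine.Nonsingular x y}
    (hP : (P : W.geomPoints) = Affine.Point.some x y h) {d : ℤ} (hd : ¬ (p : ℤ) ∣ d)
    (hint : IsIntegral ℤ (x * (d : AlgebraicClosure ℚ))) : LineUnramifiedAt W p Φ := by
  rw [lineUnramifiedAt_iff_valuation_le_one hΦ hp2 hgood hord hPΦ hP0 hP]
  -- `x·d ∈ 𝒪_𝔓` (valuation rings are integrally closed and contain `ℤ`)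
  have hle : (placeOver p).valuation (x * (d : AlgebraicClosure ℚ)) ≤ 1 :=
    (Valuation.mem_integer_iff _ _).mp
      ((integers_placeOver p).mem_of_integral (isIntegral_placeOver_of_isIntegral_int hint))
  rw [map_mul, valuation_placeOver_intCast_eq_one p hd, mul_one] at hle
  exact hle

/-- **Ramified certificate**: if `x · p · s = d` with `s` integral over `ℤ` and `d` an integer prime
to `p`, then `x ∉ 𝒪_𝔓` and `Φ` is ramified at `p` (serves `p = 3`, where canonical-subgroup abscissas
have `|x|_𝔓 = |3|⁻¹`; for `p ≥ 5` use the power form `not_lineUnramifiedAt_of_pow_mul_eq`). [folklore] -/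
theorem not_lineUnramifiedAt_of_isIntegral_inv (hΦ : IsRationalLine W p Φ) (hp2 : p ≠ 2)
    (hgood : W.HasGoodReductionAtPrime p) (hord : ¬ (p : ℤ) ∣ W.frobeniusTrace p)
    {P : geomTorsion W (p : ℤ)} (hPΦ : P ∈ Φ) (hP0 : P ≠ 0)
    {x y : AlgebraicClosure ℚ} {h : (W.baseChange (AlgebraicClosure ℚ)).toAffine.Nonsingular x y}
    (hP : (P : W.geomPoints) = Affine.Point.some x y h) {s : AlgebraicClosure ℚ} (hs : IsIntegral ℤ s)
    {d : ℤ} (hd : ¬ (p : ℤ) ∣ d) (hx : x * ((p : AlgebraicClosure ℚ) * s) = d) :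
    ¬ LineUnramifiedAt W p Φ := by
  rw [not_lineUnramifiedAt_iff_one_lt_valuation hΦ hp2 hgood hord hPΦ hP0 hP]
  have hsle : (placeOver p).valuation s ≤ 1 :=
    (Valuation.mem_integer_iff _ _).mp
      ((integers_placeOver p).mem_of_integral (isIntegral_placeOver_of_isIntegral_int hs))
  have hplt : (placeOver p).valuation ((p : ℕ) : AlgebraicClosure ℚ) < 1 :=
    valuation_placeOver_natCast_lt_one p
  have hprod : (placeOver p).valuation x * ((placeOver p).valuation ((p : ℕ) : AlgebraicClosure ℚ) *
      (placeOver p).valuation s) = 1 := by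
    rw [← map_mul, ← map_mul, hx]
    exact valuation_placeOver_intCast_eq_one p hd
  by_contra hle
  exact absurd hprod (mul_lt_one_of_nonneg_of_lt_one_right (not_lt.mp hle) zero_le
    (mul_lt_one_of_nonneg_of_lt_one_left zero_le hplt hsle)).ne

/-- **GV type (ramified ∧ even) from the two certificates**: at a good ordinary odd `p`, a rational
line `Φ` whose non-zero point `P = (x, y)` has `v_𝔓(x) > 1` and whose abscissa is a root of
`F ∈ ℚ[X]` with `Ψ₂Sq > 0` at every real root of `F` is RAMIFIED at `p` and EVEN; in particular
`GVPar W p`. [folklore] -/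
theorem gvPar_of_one_lt_valuation_of_forall_real_root_pos (hΦ : IsRationalLine W p Φ) (hp2 : p ≠ 2)
    (hgood : W.HasGoodReductionAtPrime p) (hord : ¬ (p : ℤ) ∣ W.frobeniusTrace p)
    {P : geomTorsion W (p : ℤ)} (hPΦ : P ∈ Φ) (hP0 : P ≠ 0)
    {x y : AlgebraicClosure ℚ} {h : (W.baseChange (AlgebraicClosure ℚ)).toAffine.Nonsingular x y}
    (hP : (P : W.geomPoints) = Affine.Point.some x y h) (hx : 1 < (placeOver p).valuation x)
    {F : ℚ[X]} (hF : aeval x F = 0) (hpos : ∀ r : ℝ, aeval r F = 0 → 0 < aeval r W.Ψ₂Sq) :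
    GVPar W p :=
  ⟨Φ, hΦ, Or.inl ⟨(not_lineUnramifiedAt_iff_one_lt_valuation hΦ hp2 hgood hord hPΦ hP0 hP).mpr hx,
    lineEven_of_forall_real_root_pos hΦ hp2 hPΦ hP0 hP hF hpos⟩⟩

/-- **GV type (unramified ∧ odd) from the two certificates**: `v_𝔓(x) ≤ 1` and `Ψ₂Sq < 0` at every
real root of an `F ∈ ℚ[X]` vanishing at `x` give an UNRAMIFIED ODD line, so `GVPar W p`. [folklore] -/
theorem gvPar_of_valuation_le_one_of_forall_real_root_neg (hΦ : IsRationalLine W p Φ) (hp2 : p ≠ 2)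
    (hgood : W.HasGoodReductionAtPrime p) (hord : ¬ (p : ℤ) ∣ W.frobeniusTrace p)
    {P : geomTorsion W (p : ℤ)} (hPΦ : P ∈ Φ) (hP0 : P ≠ 0)
    {x y : AlgebraicClosure ℚ} {h : (W.baseChange (AlgebraicClosure ℚ)).toAffine.Nonsingular x y}
    (hP : (P : W.geomPoints) = Affine.Point.some x y h) (hx : (placeOver p).valuation x ≤ 1)
    {F : ℚ[X]} (hF : aeval x F = 0) (hneg : ∀ r : ℝ, aeval r F = 0 → aeval r W.Ψ₂Sq < 0) :
    GVPar W p :=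
  ⟨Φ, hΦ, Or.inr ⟨(lineUnramifiedAt_iff_valuation_le_one hΦ hp2 hgood hord hPΦ hP0 hP).mpr hx,
    lineOdd_of_forall_real_root_neg hΦ hp2 hPΦ hP0 hP hF hneg⟩⟩

end Place

end KernelDisc

end Summit.BirchSwinnertonDyer.Rank1Residual

end
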